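import Summits.BirchSwinnertonDyer.Rank1Residual.X11b.Three.UnramifiedClassNodeLift
import HarnessLib

/-!
# Milne *ADT* I Prop. 3.8 in the kernel, part 1: Step 1 at a NODE with the lift IN `E₀` — the Lang–Néron lift at a place of
# multiplicative reduction returns a point of NONSINGULAR reduction
# (cell `bsd-stepL`, seat `bsd-stepL-corner3-p2` g10 = WIDTH-LEVER lane B; toward the DISCHARGE of the cite-only Literature fact
# `Milne2006_localTamagawaNumber_smul_unramifiedClass_eq_zero` (tam3-p1 g15, p614601); `--supports stmt-BirchSwinnertonDyer-21420 --as helper`)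

WHY. The (B6) precision route of the carrier-inert Shimura road (cruxes 19109 ∕ 21420 ∕ 19065) rests on ONE new printed input, Milne
*ADT* I Prop. 3.8 in Tamagawa form: «unramified classes of `H¹(K_v, E)` are killed by `c_v = [E(K_v) : E₀(K_v)]`». Its kernel proof
(this seat's discharge plan D, STATUS 2026-08-28T08:2xZ) = (i) x11b3-p8's `E₀`-valued vanishing (`UnramifiedNode`, all places) +
(ii) Kodaira–Néron over `K_v^{nr}` (tree `kodairaNeron_exists_finset_reducesToNonsingular_holds`: the group `Φ̃ = E(K_v^{nr})/E₀(K_v^{nr})`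
is finite) + (iii) a Herbrand count on the finite Frobenius-module `Φ̃` (`#Φ̃^F` kills `ker N ∕ (F − 1)Φ̃`) + (iv) the LANG–NÉRON
SURJECTIVITY `E(K_v) ↠ Φ̃^F` («every Frobenius-stable component of the special fibre carries a rational point»), which identifies
`#Φ̃^F = c_v`. Step (iv) needs Step 1 of Milne's proof WITH THE LOCATION OF THE LIFT: x11b3-p8's
`exists_lift_sub_mem_kernel_of_hasMultiplicativeReductionAt` (p256473) constructs, for `m ∈ E₀`, an `I_𝔐`-fixed `b` with
`m − (φ b − b) ∈ V₁` as a Hensel lift of a NONSINGULAR point of the node (`exists_lift_forall_inertia`), i.e. a point of `E₀`, but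
states only the existence of `b`. THIS FILE re-runs that proof VERBATIM and records the extra conjunct:
* `exists_lift_sub_mem_kernel_of_hasMultiplicativeReductionAt_mem_E0` — same hypotheses, conclusion
  `∃ b, (I_𝔐 fixes b) ∧ b ∈ E₀ ∧ m − (φ b − b) ∈ V₁` («`E₀`» = `HasNonsingularReduction` on the `𝒪_w`-model `M.map ι` through
  `Affine.Point.congrEquiv (baseChange_map_eq_baseChange_map hι M)`, exactly as in the hypothesis `hm`).
No mathematics beyond x11b3-p8's (credit: x11b3-p8 `UnramifiedClassNodeLift{,Inputs}`, the tree's `GoodReductionLangLift`,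
`NodeReductionMapProofs`, `NodeReductionGaloisProofs`); the sequel files do the cusp, the coboundary with `P ∈ E₀`, and the assembly.
HONEST FRAMING: one theorem; no definition, no named fact, no `sorry`; nothing about BSD, no stub closes, no item is credited (T7).
References: [cite: MilneADT2006, Ch. I Prop. 3.8 (proof)] [cite: SilvermanAEC2009, Prop. III.2.5(a), Prop. VII.2.1, Exercise 3.5(a), Prop. VII.5.1(b)]
[cite: NeukirchANT1999, Ch. II §6 (4.6)] [cite: LangAlgebraicGroupsFiniteFields1956, Thm. 2 (shape: torsors under connected groups over finite fields)].
-/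

set_option linter.dupNamespace false
set_option autoImplicit false

noncomputable section

open scoped Classical NNReal
open NumberField IsDedekindDomain Field Polynomial ValuativeRel

universe u

namespace Summit.BirchSwinnertonDyer.BirchSwinnertonDyer.Theorems.MilneTamagawa

open WeierstrassCurve Literature.NumberTheory.EllipticCurves
  Literature.NumberTheory.EllipticCurves.FormalGroupChart
  Literature.NumberTheory.GaloisRepresentations
  Literature.NumberTheory.GaloisRepresentations.IsNonarchimedeanLocalField IsDedekindDomain.HeightOneSpectrum
  Summit.BirchSwinnertonDyer.Rank1Residual.X11b.Three.JetchevKummer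
  Summit.BirchSwinnertonDyer.Rank1Residual.X11b.Three.UnramifiedNode

/-! ### Step 1 of Milne's proof at a node: the inertia-invariant Frobenius lift, located in `E₀` -/

section Main

variable {K : Type u} [Field K] [NumberField K] (W : WeierstrassCurve K) {v : HeightOneSpectrum (𝓞 K)}
  {w : Valuation (AlgebraicClosure (v.adicCompletion K)) ℝ≥0}
  (hw : ∀ x, (w x : ℝ) = spectralNorm (v.adicCompletion K) (AlgebraicClosure (v.adicCompletion K)) x)
  {ι : v.adicCompletionIntegers K →+* w.integer}
  (hι : ∀ a, ((ι a : w.integer) : AlgebraicClosure (v.adicCompletion K)) =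
    algebraMap (v.adicCompletion K) (AlgebraicClosure (v.adicCompletion K)) (a : v.adicCompletion K))

include hw in
set_option maxHeartbeats 1600000 in
/-- **Milne ADT I.3.8, Step 1 at a place of MULTIPLICATIVE reduction, with the lift LOCATED IN `E₀`.** Let `E/K` have
multiplicative reduction at `v`, `M = W.localMinimalIntegralModel v`, `V = M ⊗ K̄_v`, `W₀ = M.map ι` its `𝒪_w`-model, `𝔐` the
prime of `\bar 𝓞_v` above `𝓂_v` with inertia group `I_𝔐 ≤ Γ_{K_v}`, and `φ ∈ Γ_{K_v}` inducing the `q_v`-power map on residues.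
Then for every `m ∈ V(K̄_v)` with NONSINGULAR reduction on `W₀` there is `b ∈ V(K̄_v)` FIXED BY `I_𝔐`, WITH NONSINGULAR REDUCTION
on `W₀`, and with `m - (φ b - b) ∈ V₁(K̄_v)` (`FormalGroupChart.kernel`). x11b3-p8's `exists_lift_sub_mem_kernel_of_hasMultiplicativeReductionAt`
(p256473) VERBATIM — torus "Lang" `β^{±q_v}/β = r(m)`, the point of `Ẽ_ns` with `ψ`-value `β`, its `I_𝔐`-invariant Hensel lift
`b` (`exists_lift_forall_inertia`), `r(m − (φ b − b)) = 1` — with the one extra conjunct that the proof already establishes (`b`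
reduces to a nonsingular point of the node; in the trivial branch `b = O`). This located form is what the Lang–Néron
surjectivity `E(K_v) ↠ (E(K_v^{nr})/E₀(K_v^{nr}))^{Frob}` needs. [cite: MilneADT2006, Ch. I Prop. 3.8 (proof)]
[cite: SilvermanAEC2009, Prop. III.2.5(a), Prop. VII.2.1, Exercise 3.5(a), Prop. VII.5.1(b)] -/
theorem exists_lift_sub_mem_kernel_of_hasMultiplicativeReductionAt_mem_E0 [W.IsElliptic]
    (hmult : W.HasMultiplicativeReductionAt v)
    {𝔐 : Ideal v.localAbsIntegers} (h𝔐 : 𝔐 ∈ v.localPrimesAbove)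
    [hV : (((W.localMinimalIntegralModel v).map
        (algebraMap (v.adicCompletionIntegers K) (v.adicCompletion K))).baseChange
        (AlgebraicClosure (v.adicCompletion K))).IsIntegral w.integer]
    (hι : ∀ a, ((ι a : w.integer) : AlgebraicClosure (v.adicCompletion K)) =
      algebraMap (v.adicCompletion K) (AlgebraicClosure (v.adicCompletion K)) (a : v.adicCompletion K))
    {φ : absoluteGaloisGroup (v.adicCompletion K)}
    (hφq : ∀ z : AlgebraicClosure (v.adicCompletion K), w z ≤ 1 →
      w (absoluteGaloisGroup.toAlgEquiv (v.adicCompletion K) φ z -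
        z ^ Nat.card (IsLocalRing.ResidueField (v.adicCompletionIntegers K))) < 1)
    (m : (((W.localMinimalIntegralModel v).map
        (algebraMap (v.adicCompletionIntegers K) (v.adicCompletion K))).baseChange
        (AlgebraicClosure (v.adicCompletion K))).toAffine.Point)
    (hm : ((W.localMinimalIntegralModel v).map ι).HasNonsingularReduction
      (Affine.Point.congrEquiv (baseChange_map_eq_baseChange_map hι (W.localMinimalIntegralModel v)) m)) :
    ∃ b : (((W.localMinimalIntegralModel v).map
        (algebraMap (v.adicCompletionIntegers K) (v.adicCompletion K))).baseChange
        (AlgebraicClosure (v.adicCompletion K))).toAffine.Point,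
      (∀ τ ∈ 𝔐.inertia (absoluteGaloisGroup (v.adicCompletion K)),
        WeierstrassCurve.Affine.Point.map (W' := (W.localMinimalIntegralModel v).map (algebraMap (v.adicCompletionIntegers K) (v.adicCompletion K))) ((absoluteGaloisGroup.toAlgEquiv (v.adicCompletion K) τ :
          AlgebraicClosure (v.adicCompletion K) ≃ₐ[v.adicCompletion K] AlgebraicClosure (v.adicCompletion K)) :
          AlgebraicClosure (v.adicCompletion K) →ₐ[v.adicCompletion K] AlgebraicClosure (v.adicCompletion K)) b = b) ∧
      ((W.localMinimalIntegralModel v).map ι).HasNonsingularReduction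
        (Affine.Point.congrEquiv (baseChange_map_eq_baseChange_map hι (W.localMinimalIntegralModel v)) b) ∧
      m - (WeierstrassCurve.Affine.Point.map (W' := (W.localMinimalIntegralModel v).map (algebraMap (v.adicCompletionIntegers K) (v.adicCompletion K))) ((absoluteGaloisGroup.toAlgEquiv (v.adicCompletion K) φ :
          AlgebraicClosure (v.adicCompletion K) ≃ₐ[v.adicCompletion K] AlgebraicClosure (v.adicCompletion K)) :
          AlgebraicClosure (v.adicCompletion K) →ₐ[v.adicCompletion K] AlgebraicClosure (v.adicCompletion K)) b - b)
        ∈ FormalGroupChart.kernel w (((W.localMinimalIntegralModel v).map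
            (algebraMap (v.adicCompletionIntegers K) (v.adicCompletion K))).baseChange
            (AlgebraicClosure (v.adicCompletion K))) := by
  have hvw : w.Integers w.integer := Valuation.integer.integers w
  have hφw : ∀ z, w (absoluteGaloisGroup.toAlgEquiv (v.adicCompletion K) φ z) = w z :=
    fun z ↦ spectralValuation_smul hw φ z
  have hq2 := two_le_natCard_residueField (K := K) (v := v)
  haveI : IsAlgClosed (IsLocalRing.ResidueField w.integer) := isAlgClosed_residueField_integer w
  -- the curve `V` is elliptic
  haveI hVell : ((((W.localMinimalIntegralModel v).map (algebraMap (v.adicCompletionIntegers K) (v.adicCompletion K))).baseChange (AlgebraicClosure (v.adicCompletion K)))).IsElliptic := by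
    haveI := W.isElliptic_localMinimalModel v
    have hM : (W.localMinimalIntegralModel v).map (algebraMap (v.adicCompletionIntegers K) (v.adicCompletion K)) = W.localMinimalModel v :=
      baseChange_integralModel_eq (v.adicCompletionIntegers K) (W.localMinimalModel v)
    rw [hM]
    infer_instance
  -- the model over `𝒪_w`
  have hX : ((W.localMinimalIntegralModel v).map (algebraMap (v.adicCompletionIntegers K) (v.adicCompletion K))).baseChange
      (AlgebraicClosure (v.adicCompletion K)) = ((W.localMinimalIntegralModel v).map ι).baseChange (AlgebraicClosure (v.adicCompletion K)) :=
    baseChange_map_eq_baseChange_map hι (W.localMinimalIntegralModel v)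
  -- kernel membership is reduction to `O` on `((W.localMinimalIntegralModel v).map ι)`
  have hker : ∀ P : (((W.localMinimalIntegralModel v).map (algebraMap (v.adicCompletionIntegers K) (v.adicCompletion K))).baseChange
      (AlgebraicClosure (v.adicCompletion K))).toAffine.Point,
      ((W.localMinimalIntegralModel v).map ι).ReducesToZero (Affine.Point.congrEquiv hX P) ↔ P ∈ FormalGroupChart.kernel w
        (((W.localMinimalIntegralModel v).map (algebraMap (v.adicCompletionIntegers K) (v.adicCompletion K))).baseChange
          (AlgebraicClosure (v.adicCompletion K))) := by
    intro P
    rcases P with _ | ⟨x, y, h⟩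
    · rw [← Affine.Point.zero_def, map_zero]
      exact iff_of_true WeierstrassCurve.reducesToZero_zero
        (fun he ↦ (Affine.Point.some_ne_zero _ he.symm).elim)
    · rw [Affine.Point.congrEquiv_some, WeierstrassCurve.reducesToZero_some_iff,
        not_mem_range_iff hvw, FormalGroupChart.some_mem_kernel_iff]
  -- the node presentation of `W̃₀` and the reduction map onto the torus
  obtain ⟨x₀, y₀, α₁, α₂, hα, hW⟩ :=
    exists_map_residue_eq_singularModel_of_hasMultiplicativeReductionAt hw hι hmult
  obtain ⟨r, hr0, hr⟩ := exists_addMonoidHom_units_of_map_eq_singularModel ((W.localMinimalIntegralModel v).map ι) hvw hW hα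
  -- the Galois rule for `φ` (Silverman Ex. 3.5(a))
  obtain ⟨σk, hσk, hstab, -, -, hdich⟩ := exists_residueMap_nodeReduction_smul ((W.localMinimalIntegralModel v).map ι) hX
    ((absoluteGaloisGroup.toAlgEquiv (v.adicCompletion K) φ :
      AlgebraicClosure (v.adicCompletion K) ≃ₐ[v.adicCompletion K] AlgebraicClosure (v.adicCompletion K)) :
      AlgebraicClosure (v.adicCompletion K) →ₐ[v.adicCompletion K] AlgebraicClosure (v.adicCompletion K))
    (fun z ↦ hφw z) hW r hr0 hr
  -- `φ̄` is the `q`-power map of `k_{𝒪_w}`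
  have hσkq : ∀ x : IsLocalRing.ResidueField w.integer,
      σk x = x ^ Nat.card (IsLocalRing.ResidueField (v.adicCompletionIntegers K)) := by
    intro x
    obtain ⟨z, rfl⟩ := IsLocalRing.residue_surjective x
    have hz : w (z : AlgebraicClosure (v.adicCompletion K)) ≤ 1 := z.2
    have hφz : w (absoluteGaloisGroup.toAlgEquiv (v.adicCompletion K) φ
        (z : AlgebraicClosure (v.adicCompletion K))) ≤ 1 := by rw [hφw]; exact hz
    have hzq : w ((z : AlgebraicClosure (v.adicCompletion K)) ^
        Nat.card (IsLocalRing.ResidueField (v.adicCompletionIntegers K))) ≤ 1 := by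
      rw [map_pow]; exact pow_le_one₀ zero_le hz
    have h1 := hσk (z : AlgebraicClosure (v.adicCompletion K)) hz hφz
    rw [h1]
    refine (WeierstrassCurve.residue_eq_of_val_sub_lt_one (w := w) hzq hφz (hφq _ hz)).trans ?_
    rw [← map_pow]
    exact congrArg _ (Subtype.ext (by simp))
  -- `m` in `E₀`, its value `a = r(m)`
  have hmE : Affine.Point.congrEquiv hX m ∈ ((W.localMinimalIntegralModel v).map ι).nonsingularReductionSubgroup hvw := hm
  have ha0 : ((Additive.toMul (r ⟨_, hmE⟩) : (IsLocalRing.ResidueField w.integer)ˣ) :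
      IsLocalRing.ResidueField w.integer) ≠ 0 := (Additive.toMul (r ⟨_, hmE⟩)).ne_zero
  -- trivial case `m ∈ V₁`
  by_cases hrm : r ⟨_, hmE⟩ = 0
  · refine ⟨0, fun τ _ ↦ by rw [map_zero], by rw [map_zero]; exact hasNonsingularReduction_zero, ?_⟩
    rw [map_zero, sub_self, sub_zero]
    exact (hker m).mp ((hr0 ⟨_, hmE⟩).mp hrm)
  -- the Galois rule as a signed exponent `e = ±1`: `r(φ P) = ((r P)^q)^e`
  obtain ⟨e, he, hrule⟩ : ∃ e : ℤ, (e = 1 ∨ e = -1) ∧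
      ∀ (P : (((W.localMinimalIntegralModel v).map (algebraMap (v.adicCompletionIntegers K) (v.adicCompletion K))).baseChange
          (AlgebraicClosure (v.adicCompletion K))).toAffine.Point)
        (hP : ((W.localMinimalIntegralModel v).map ι).HasNonsingularReduction (Affine.Point.congrEquiv hX P))
        (hσP : ((W.localMinimalIntegralModel v).map ι).HasNonsingularReduction (Affine.Point.congrEquiv hX (Affine.Point.map
          ((absoluteGaloisGroup.toAlgEquiv (v.adicCompletion K) φ :
            AlgebraicClosure (v.adicCompletion K) ≃ₐ[v.adicCompletion K] AlgebraicClosure (v.adicCompletion K)) :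
            AlgebraicClosure (v.adicCompletion K) →ₐ[v.adicCompletion K] AlgebraicClosure (v.adicCompletion K)) P))),
        ((Additive.toMul (r ⟨_, hσP⟩) : (IsLocalRing.ResidueField w.integer)ˣ) :
            IsLocalRing.ResidueField w.integer) =
          ((((Additive.toMul (r ⟨_, hP⟩) : (IsLocalRing.ResidueField w.integer)ˣ) :
            IsLocalRing.ResidueField w.integer)) ^
              Nat.card (IsLocalRing.ResidueField (v.adicCompletionIntegers K))) ^ e := by
    rcases hdich with ⟨-, -, h⟩ | ⟨-, -, h⟩
    · exact ⟨1, Or.inl rfl, fun P hP hσP ↦ by rw [zpow_one, h P hP hσP, hσkq]⟩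
    · exact ⟨-1, Or.inr rfl, fun P hP hσP ↦ by rw [zpow_neg_one, h P hP hσP, hσkq]⟩
  -- "Lang for the torus": `a · β = (β^q)^e`
  obtain ⟨β, hβ0, hβ⟩ : ∃ β : IsLocalRing.ResidueField w.integer, β ≠ 0 ∧
      ((Additive.toMul (r ⟨_, hmE⟩) : (IsLocalRing.ResidueField w.integer)ˣ) :
        IsLocalRing.ResidueField w.integer) * β =
        (β ^ Nat.card (IsLocalRing.ResidueField (v.adicCompletionIntegers K))) ^ e := by
    rcases he with rfl | rfl
    · obtain ⟨β, hβ0, hβ⟩ := exists_pow_eq_mul_self hq2 ha0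
      exact ⟨β, hβ0, by rw [zpow_one, hβ]⟩
    · obtain ⟨β, hβ0, hβ⟩ :=
        exists_mul_mul_pow_eq_one (Nat.card (IsLocalRing.ResidueField (v.adicCompletionIntegers K))) ha0
      refine ⟨β, hβ0, ?_⟩
      rw [zpow_neg_one, ← mul_eq_one_iff_eq_inv₀ (pow_ne_zero _ hβ0)]
      exact hβ
  -- the point of `Ẽ_ns` with `ψ`-value `β`; it is not `Õ` since `a ≠ 1`
  obtain ⟨Q, hQ⟩ := singularModel.nodeHom_surjective (x₀ := x₀) (y₀ := y₀) hα
    (Additive.ofMul (Units.mk0 β hβ0))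
  rcases Q with _ | ⟨αQ, βQ, hnsQ⟩
  · exfalso
    rw [← Affine.Point.zero_def, map_zero] at hQ
    have hβ1 : β = 1 := by
      have h1 := congrArg (fun t ↦ ((Additive.toMul t : (IsLocalRing.ResidueField w.integer)ˣ) :
        IsLocalRing.ResidueField w.integer)) hQ
      simpa using h1.symm
    rw [hβ1, mul_one, one_pow, one_zpow] at hβ
    apply hrm
    apply Additive.toMul.injective
    ext
    rw [toMul_zero, Units.val_one]
    exact hβ
  -- the lift of `Q = (αQ, βQ)` to an `I_𝔐`-invariant `𝒪_w`-point `(a₁, b₁)` of `((W.localMinimalIntegralModel v).map ι)`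
  have hnsW : (((W.localMinimalIntegralModel v).map ι).map (IsLocalRing.residue w.integer)).toAffine.Nonsingular αQ βQ := by
    rw [hW]; exact hnsQ
  obtain ⟨a₁, b₁, hab, ha₁, hb₁, ha₁I, hb₁I⟩ := exists_lift_forall_inertia hw hι h𝔐 (W.localMinimalIntegralModel v) hnsW
  have hL : (((W.localMinimalIntegralModel v).map (algebraMap (v.adicCompletionIntegers K) (v.adicCompletion K))).baseChange
      (AlgebraicClosure (v.adicCompletion K))).toAffine.Nonsingular
      (a₁ : AlgebraicClosure (v.adicCompletion K)) (b₁ : AlgebraicClosure (v.adicCompletion K)) := by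
    rw [← Affine.equation_iff_nonsingular, hX]
    exact (map_equation_iff hvw.hom_inj).mpr hab
  have hL' : (((W.localMinimalIntegralModel v).map ι).baseChange (AlgebraicClosure (v.adicCompletion K))).toAffine.Nonsingular
      (algebraMap w.integer (AlgebraicClosure (v.adicCompletion K)) a₁)
      (algebraMap w.integer (AlgebraicClosure (v.adicCompletion K)) b₁) := by
    have h := hL; rw [hX] at h; exact h
  have hns_res : (singularModel x₀ y₀ α₁ α₂).toAffine.Nonsingular (IsLocalRing.residue w.integer a₁)
      (IsLocalRing.residue w.integer b₁) := by
    rw [ha₁, hb₁]; exact hnsQ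
  have hbE' : ∀ h', ((W.localMinimalIntegralModel v).map ι).HasNonsingularReduction
      (.some (algebraMap w.integer (AlgebraicClosure (v.adicCompletion K)) a₁)
        (algebraMap w.integer (AlgebraicClosure (v.adicCompletion K)) b₁) h') := fun h' ↦
    (hasNonsingularReduction_some_algebraMap_iff hvw.hom_inj h').mpr (by rw [hW]; exact hns_res)
  have hcongr : Affine.Point.congrEquiv hX (.some _ _ hL) = .some _ _ hL' := by
    rw [Affine.Point.congrEquiv_some]; rfl
  have hbE : ((W.localMinimalIntegralModel v).map ι).HasNonsingularReduction (Affine.Point.congrEquiv hX (.some _ _ hL)) := by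
    rw [hcongr]; exact hbE' _
  -- `r(b) = β`
  have hrb : ((Additive.toMul (r ⟨_, hbE⟩) : (IsLocalRing.ResidueField w.integer)ˣ) :
      IsLocalRing.ResidueField w.integer) = β := by
    have h1 : (⟨Affine.Point.congrEquiv hX (.some _ _ hL), hbE⟩ : ((W.localMinimalIntegralModel v).map ι).nonsingularReductionSubgroup hvw) =
        ⟨.some _ _ hL', hbE' hL'⟩ := Subtype.ext hcongr
    rw [h1, hr a₁ b₁ hL' hns_res (hbE' hL')]
    have h2 : (WeierstrassCurve.Affine.Point.some _ _ hns_res :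
        (singularModel x₀ y₀ α₁ α₂).toAffine.Point) = .some αQ βQ hnsQ :=
      point_some_eq_some ha₁ hb₁
    rw [h2, ← singularModel.coe_toMul_nodeHom, hQ]
    rfl
  -- `φ b ∈ E₀`, and `b` is fixed by `I_𝔐`
  have hφbE := hstab _ hbE
  refine ⟨.some _ _ hL, fun τ hτ ↦ ?_, hbE, ?_⟩
  · rw [Affine.Point.map_some]
    exact point_some_eq_some (ha₁I τ hτ) (hb₁I τ hτ)
  -- `r(m - (φ b - b)) = a · β / (β^q)^e = 1`
  have key : r (⟨_, hmE⟩ - (⟨_, hφbE⟩ - ⟨_, hbE⟩)) = 0 := by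
    rw [map_sub, map_sub]
    apply Additive.toMul.injective
    rw [toMul_sub, toMul_sub, toMul_zero]
    ext
    rw [Units.val_div_eq_div_val, Units.val_div_eq_div_val, Units.val_one, hrule _ hbE hφbE, hrb,
      div_div_eq_mul_div, div_eq_one_iff_eq (zpow_ne_zero _ (pow_ne_zero _ hβ0)), hβ]
  have hred := (hr0 _).mp key
  rw [← hker]
  simpa only [AddSubgroupClass.coe_sub, map_sub] using hred

end Main

end Summit.BirchSwinnertonDyer.BirchSwinnertonDyer.Theorems.MilneTamagawa

end
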